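import Summits.RiemannHypothesis.RiemannHypothesis.Theorems.TiltedLandingLaw421R2NodeDR
import Summits.RiemannHypothesis.RiemannHypothesis.Theses.EarlyAppointments

/-! # trkD_v2R — W-08 ROUND-2 LINE for crux `TiltedLandingLaw421` (stmt-RiemannHypothesis-24774): tracked down-first lineage `StTrkD`, stop `ReadyR2 := CumReady (WindowReady ∨ TiltReady)`,
HEIGHT purse + SIGNED tolls read at the BOOKED-ROOT meter `tentMeterTrkD (3/2)` (C1 §R2Ke row R5ᴿ; C6 ADD-79: the `tentMeterMax` twin `ZRestTrkDHF′` has legal k-0 NEGs in-model, R5ᴿ NEG 0/1 877).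
C1 DRY image — NOT keyed, NOT registered (registration = lead on a director line).
STUBS (2): `stub_zRestTrkDHFR' : RhW08.Round2.ZRestTrkDHFR'` and `stub_alphaSealTrkD' : RhW08.Round2.AlphaSealTrkD'`.  COMPOSITION (0 sorry outside the stubs): `RhW08.R2Node.law421T_of_round2DFR` ⇒ the ROUTE DECL BY NAME.
Typed ≠ proved; models (combs) ≠ ξ; RH is NOT proved. -/

namespace Summit.RiemannHypothesis.RiemannHypothesis.Cruxes.TiltedLandingLaw421.TrkDV2R

set_option linter.dupNamespace false

/-- STUB (REST′ᴿ, signed tolls, height purse, booked-root meter) — `RhW08.Round2.ZRestTrkDHFR'`. -/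
theorem stub_zRestTrkDHFR' : RhW08.Round2.ZRestTrkDHFR' := by
  sorry

/-- STUB (α′) — `RhW08.Round2.AlphaSealTrkD'` = isolated-pair drop-low on lowest TRACKED states sealed by `PSealC4`, stop `ReadyR2`. -/
theorem stub_alphaSealTrkD' : RhW08.Round2.AlphaSealTrkD' := by
  sorry

/-- **COMPOSITION** — the stubs prove the crux `TiltedLandingLaw421` (route `EarlyAppointments`, stmt-RiemannHypothesis-24774) BY NAME. -/
theorem TiltedLandingLaw421_of : Summit.RiemannHypothesis.RiemannHypothesis.Theses.EarlyAppointments.TiltedLandingLaw421 :=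
  RhW08.R2Node.law421T_of_round2DFR stub_zRestTrkDHFR' stub_alphaSealTrkD'

end Summit.RiemannHypothesis.RiemannHypothesis.Cruxes.TiltedLandingLaw421.TrkDV2R
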